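import Summits.QuantumFields.YangMills.Theorems.UnitScaleTiltCoverSitesBlocks
import Literature.MathematicalPhysics.QuantumFieldTheory.Balaban1983to89.T3Thm1Carrier
import HarnessLib

/-!
# Route `UnitScaleTilt`, crux K1 child «MinimiserStabilityRegPr» (stmt-QuantumFields-19200), registered stub `stub_halvingStep` (H) — H-SMALL route (b7) ∕ (R-b″)
# «COVER LIFT» (★★OWNER RULINGS №28–№30), brick **DECK NATURALITY**: the (0.4) block average, its iterates, the transports and the plaquette holonomies are
# NATURAL under every BLOCK-COMPATIBLE LATTICE ENDOMORPHISM, and the DECK TRANSLATIONS of the `L^{jc}`-fold cover `F.cover jc` (✓`CoverSites` :53, :158)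
# are such endomorphisms — so the (0.4) average on the cover COMMUTES WITH THE DECK GROUP (the covariance FILE 2 ∕ `stat_cover_of_isCritR2` of
# `ym-ust-20520-w3` g5's lift package needs for the deck equivariance of the linearised average at a deck-invariant point)

Cell `ym3-torus` (HUMAN RULING D-0037, YM ladder rung R3 — continuum SU(2) YM₃ on the torus is a RUNG, not the Clay problem); typed by the free reserve seat
`ym-inputs-p06` (g3) of desk `pub/ym-inputs` on `ym-ust-20520-w3` g5's split «p06: (a)» (HOME STATUS 2026-08-28T11:29:15Z).  `--supports … --as helper`;
def-free, 0 sorry, standard axioms.  NOT a claim about the stub, the crux, the rung or a mass gap.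

WHY.  The sibling file `…HalvingSmallMembersCoverLift` (w3-20520 g5) proves that the (0.4) average commutes with the COVERING MAP `proj` (the instance needed to
lift the datum).  The first-variation push-forward of FILE 2 also needs the average on the cover to commute with the DECK TRANSLATIONS `x̃ ↦ x̃ + t`,
`proj t = proj 0` (so that the derivative of `Averaging.iter (blockAvg ℰ)` at the deck-invariant lift `Ũ = U ∘ projBond` is deck-equivariant, and the deck-orbit
sum `Σ_t τ_t^* Ẏ = (pushBond Ẏ) ∘ projBond` of a cover fibre tangent is again annihilated).  Both are instances of ONE fact: naturality under a family of
lattice maps commuting with `shift`, `unshift` and the block-centre embedding `emb` — §1 proves that fact once for ENDOMORPHISMS of a lattice `Q` (the cast-free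
case; the two-lattice `proj` instance is w3's file), §2 shows that the deck translations of `cover P jc` are such endomorphisms, §3 draws the instances.

WHAT IS PROVED (no definition; `φ : (i : ℕ) → Site Q i → Site Q i` with `hs : φ (x + e_μ) = φ x + e_μ`, `hu : φ (x − e_μ) = φ x − e_μ`,
`hemb : φ_i (emb y) = emb (φ_{i+1} y)` in the standing range; the induced bond map is written inline `b ↦ ⟨φ_i b.src, b.dir⟩`).
* §1 `holT_comp_map`, `holAt_walk_comp_map`, `map_walkEnd`, `plaqHol_comp_map`, `plaqFT_comp_map`, `covDerivT_comp_map`, `covDivT_comp_map` (graph homomorphism);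
  `map_lineSite`, `pathProd_comp_map`, `axialAvg_comp_map`, `loopHol_comp_map`, `small_comp_map_iff`, `corr_comp_map`, ★`avgFun_comp_map`, ★`iter_blockAvg_comp_map`
  (the (0.4) average `BlockAveraging.avgFun ℰ` and `Averaging.iter (blockAvg ℰ)` are natural: `M(U ∘ φ♭_j) = M(U) ∘ φ♭_{j+1}`).
* §2 the deck translations `τ_c,i : x̃ ↦ (ν ↦ x̃ ν + c ν · (2L^{m+K−i}))` of `cover P jc` (`c : Fin d → ℕ`): `deck_shift`, `deck_unshift`, ★`emb_deck` (`emb (τ_{i+1} ỹ) = τ_i (emb ỹ)`,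
  `i + 1 ≤ m + K`: `(c·2L^{m+K−i−1})·L = c·2L^{m+K−i}`), `proj_deck` (`proj ∘ τ = proj`), `deck_neg_cancel` ∕ `deck_bijective` (translation by the opposite vector inverts).
* §3 instances: ★`plaqHol_comp_deck`, `plaqSmall_comp_deck_iff`, ★`covDivT_comp_deck`, ★★`avgFun_comp_deck`, ★★`iter_blockAvg_comp_deck`, ★`wilsonAction_comp_deck` (the action is
  deck-INVARIANT: reindex the plaquette sum along the bijection), `comp_deck_comp_projBond` (a LIFT is deck-invariant: `(U ∘ projBond) ∘ τ♭ = U ∘ projBond`).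
HONEST SCOPE.  Finite-torus bookkeeping and the locality∕covariance structure of [Balaban1987RG1] (0.4) already certified in `BlockAveraging`; no analysis, no estimate;
nothing of the H stub, the crux, T⁴ or a mass gap is claimed.

References: T. Bałaban, *Renormalization group approach to lattice gauge field theories. I*, Commun. Math. Phys. **109** (1987) 249–301 [Balaban1987RG1] ((0.1)–(0.4) pp.251–253,
(0.11) p.253); T. Bałaban, *Averaging operations for lattice gauge theories*, Commun. Math. Phys. **98** (1985) 17–51 [Balaban1985Averaging] ((5), (9), (11) pp.18–19);
T. Bałaban, CMP **99** (1985) 75–102 [Balaban1985RegularSpaces] ((1.1)–(1.2) p.76).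
-/

set_option autoImplicit false

open scoped BigOperators Matrix.Norms.L2Operator

namespace Summit.QuantumFields.YangMills.Theorems.CoverDeckNaturality

open Literature.MathematicalPhysics.QuantumFieldTheory.Balaban1983to89
open T4Continuum AveragingRT BlockAveraging
open B10Eq27TorusAxialLog (holT)
open B10Eq68TorusRegularity (plaqFT covDerivT covDivT)
open T3ContinuumYM3Torus (T3Family)
open CoverSites

/-! ## §1 Naturality under block-compatible lattice endomorphisms -/

section Endo

variable {Q : Params} (φ : (i : ℕ) → Site Q i → Site Q i)
  (hs : ∀ (i : ℕ) (x : Site Q i) (μ : Fin Q.d), φ i (x.shift μ) = (φ i x).shift μ)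
  (hu : ∀ (i : ℕ) (x : Site Q i) (μ : Fin Q.d), φ i (x.unshift μ) = (φ i x).unshift μ)

section Graph

variable {G : Type*} [Group G] {j : ℕ}

include hs hu in
/-- **TRANSPORT ALONG A WORD IS NATURAL** (`B10Eq27TorusAxialLog.holT` spelling): `(V ∘ φ♭)(Γ_{x,w}) = V(Γ_{φ x, w})`. [cite: Balaban1985Averaging, (9) p.18] -/
theorem holT_comp_map (V : GaugeField Q j G) :
    ∀ (w : List (Letter Q.d)) (x : Site Q j), holT (V ∘ fun b : PBond Q j => (⟨φ j b.src, b.dir⟩ : PBond Q j)) x w = holT V (φ j x) w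
  | [], x => by simp [B10Eq27TorusAxialLog.holT]
  | (μ, true) :: w, x => by
    rw [B10Eq27TorusAxialLog.holT_cons_true, B10Eq27TorusAxialLog.holT_cons_true, holT_comp_map V w, hs]
    rfl
  | (μ, false) :: w, x => by
    rw [B10Eq27TorusAxialLog.holT_cons_false, B10Eq27TorusAxialLog.holT_cons_false, holT_comp_map V w, hu]
    simp only [Function.comp_apply, hu]

end Graph

section GraphGG

variable {G : Type*} [GaugeGroup G] {j : ℕ}

include hs hu in
/-- **TRANSPORT ALONG A WALK IS NATURAL** (`T4Continuum.holAt ∘ walk` spelling of the (0.4) loop variables). [cite: Balaban1985Averaging, (9) p.18] -/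
theorem holAt_walk_comp_map (U : GaugeField Q j G) :
    ∀ (w : List (Letter Q.d)) (x : Site Q j), holAt (U ∘ fun b : PBond Q j => (⟨φ j b.src, b.dir⟩ : PBond Q j)) (walk x w) = holAt U (walk (φ j x) w)
  | [], x => by simp [walk, holAt]
  | (μ, true) :: w, x => by
    have ih := holAt_walk_comp_map U w (x.shift μ)
    simp only [walk, holAt, List.map_cons, List.prod_cons, Function.comp_apply, ite_true] at ih ⊢
    rw [ih, hs]
  | (μ, false) :: w, x => by
    have ih := holAt_walk_comp_map U w (x.unshift μ)
    simp only [walk, holAt, List.map_cons, List.prod_cons, Function.comp_apply] at ih ⊢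
    rw [ih, hu]

include hs hu in
/-- the end of a walk is natural. [folklore] -/
theorem map_walkEnd : ∀ (w : List (Letter Q.d)) (x : Site Q j), φ j (walkEnd x w) = walkEnd (φ j x) w
  | [], x => rfl
  | (μ, true) :: w, x => by rw [walkEnd, walkEnd, map_walkEnd w, hs]
  | (μ, false) :: w, x => by rw [walkEnd, walkEnd, map_walkEnd w, hu]

include hs in
/-- ★ **PLAQUETTE HOLONOMIES ARE NATURAL**: `(U ∘ φ♭)(∂p) = U(∂(φ p))`. [cite: Balaban1985Averaging, (9) p.19] -/
theorem plaqHol_comp_map (U : GaugeField Q j G) (p : Plaq Q j) :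
    GaugeField.plaqHol (U ∘ fun b : PBond Q j => (⟨φ j b.src, b.dir⟩ : PBond Q j)) p = GaugeField.plaqHol U ⟨φ j p.src, p.μ, p.ν, p.hμν⟩ := by
  simp only [GaugeField.plaqHol, Function.comp_apply, hs]

include hs in
/-- `PlaqSmall` is inherited by the pulled-back field (one direction; the converse needs `φ` onto, §3). [cite: Balaban1987RG1, (0.18) p.255] -/
theorem plaqSmall_comp_map {δ : ℝ} {U : GaugeField Q j G} (h : PlaqSmall δ U) :
    PlaqSmall δ (U ∘ fun b : PBond Q j => (⟨φ j b.src, b.dir⟩ : PBond Q j)) :=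
  fun p => by rw [plaqHol_comp_map φ hs]; exact h _

end GraphGG

section Units

variable {𝔸 : Type*} [NormedRing 𝔸] [NormedAlgebra ℂ 𝔸] {j : ℕ}

omit [NormedAlgebra ℂ 𝔸] in
include hs hu in
/-- plaquette fields of the pulled-back field. [cite: Balaban1985RegularSpaces, (1.2) p.76] -/
theorem plaqFT_comp_map (V : GaugeField Q j 𝔸ˣ) (μ ν : Fin Q.d) (x : Site Q j) :
    plaqFT (V ∘ fun b : PBond Q j => (⟨φ j b.src, b.dir⟩ : PBond Q j)) μ ν x = plaqFT V μ ν (φ j x) := by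
  unfold B10Eq68TorusRegularity.plaqFT
  rw [holT_comp_map φ hs hu]

include hu in
/-- the backward covariant derivative of a pulled-back site function along the pulled-back field. [cite: Balaban1985RegularSpaces, (1.1) p.76] -/
theorem covDerivT_comp_map (η : ℝ) (V : GaugeField Q j 𝔸ˣ) (ν : Fin Q.d) (f : Site Q j → 𝔸) (x : Site Q j) :
    covDerivT η (V ∘ fun b : PBond Q j => (⟨φ j b.src, b.dir⟩ : PBond Q j)) ν (f ∘ φ j) x = covDerivT η V ν f (φ j x) := by
  unfold B10Eq68TorusRegularity.covDerivT
  simp only [Function.comp_apply, hu]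

include hs hu in
/-- ★ **THE COVARIANT DIVERGENCE IS NATURAL**. [cite: Balaban1985RegularSpaces, (1.2) p.76] -/
theorem covDivT_comp_map (η : ℝ) (V : GaugeField Q j 𝔸ˣ) (μ : Fin Q.d) (x : Site Q j) :
    covDivT η (V ∘ fun b : PBond Q j => (⟨φ j b.src, b.dir⟩ : PBond Q j)) μ x = covDivT η V μ (φ j x) := by
  unfold B10Eq68TorusRegularity.covDivT
  have h : ∀ κ κ' : Fin Q.d, plaqFT (V ∘ fun b : PBond Q j => (⟨φ j b.src, b.dir⟩ : PBond Q j)) κ κ' = plaqFT V κ κ' ∘ φ j := fun κ κ' => by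
    funext y; exact plaqFT_comp_map φ hs hu V κ κ' y
  simp only [h, covDerivT_comp_map φ hu]

end Units

section Average

variable {G : Type*} [GaugeGroup G] {j : ℕ}

include hs in
/-- the straight-line sites of a coarse bond are natural (block-centre compatibility at the one level `j`). [cite: Balaban1984PropagatorsI, (1.7) p.18] -/
theorem map_lineSite (hembj : ∀ y : Site Q (j + 1), φ j (emb y) = emb (φ (j + 1) y)) (c : PBond Q (j + 1)) (t : ℕ) :
    φ j (lineSite c t) = lineSite (⟨φ (j + 1) c.src, c.dir⟩ : PBond Q (j + 1)) t := by
  induction t with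
  | zero =>
    show φ j (Function.update (emb c.src) c.dir (emb c.src c.dir + ((0 : ℕ) : ZMod (Q.sitesPerDir j)))) =
      Function.update (emb (φ (j + 1) c.src)) c.dir (emb (φ (j + 1) c.src) c.dir + ((0 : ℕ) : ZMod (Q.sitesPerDir j)))
    rw [Nat.cast_zero, add_zero, add_zero, Function.update_eq_self, Function.update_eq_self, hembj]
  | succ t ih =>
    rw [lineSite_succ, lineSite_succ, hs, ih]

include hs in
/-- partial transports along the straight line are natural. [cite: Balaban1984PropagatorsI, (1.7) p.18] -/
theorem pathProd_comp_map (hembj : ∀ y : Site Q (j + 1), φ j (emb y) = emb (φ (j + 1) y)) (U : GaugeField Q j G) (c : PBond Q (j + 1)) :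
    ∀ n : ℕ, pathProd (U ∘ fun b : PBond Q j => (⟨φ j b.src, b.dir⟩ : PBond Q j)) c n = pathProd U (⟨φ (j + 1) c.src, c.dir⟩ : PBond Q (j + 1)) n
  | 0 => rfl
  | n + 1 => by
    rw [pathProd, pathProd, pathProd_comp_map hembj U c n]
    simp only [Function.comp_apply, AveragingRT.line, map_lineSite φ hs hembj]

include hs in
/-- **THE AXIAL AVERAGE IS NATURAL**. [cite: Balaban1984PropagatorsI, (1.7) p.18] -/
theorem axialAvg_comp_map (hembj : ∀ y : Site Q (j + 1), φ j (emb y) = emb (φ (j + 1) y)) (U : GaugeField Q j G) :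
    axialAvg (U ∘ fun b : PBond Q j => (⟨φ j b.src, b.dir⟩ : PBond Q j)) = axialAvg U ∘ fun c : PBond Q (j + 1) => (⟨φ (j + 1) c.src, c.dir⟩ : PBond Q (j + 1)) := by
  funext c
  exact pathProd_comp_map φ hs hembj U c Q.L

include hs hu in
/-- **THE (0.4) LOOP VARIABLES ARE NATURAL** (same index family `Idx Q`). [cite: Balaban1987RG1, (0.4) p.253] -/
theorem loopHol_comp_map (hembj : ∀ y : Site Q (j + 1), φ j (emb y) = emb (φ (j + 1) y)) (U : GaugeField Q j G) (c : PBond Q (j + 1)) (i : Idx Q) :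
    loopHol (U ∘ fun b : PBond Q j => (⟨φ j b.src, b.dir⟩ : PBond Q j)) c i = loopHol U (⟨φ (j + 1) c.src, c.dir⟩ : PBond Q (j + 1)) i := by
  unfold BlockAveraging.loopHol
  rw [holAt_walk_comp_map φ hs hu, hembj]

variable (ℰ : LoopAverage G)

include hs hu in
/-- the small-field guard of (0.4) is natural, bondwise. [cite: Balaban1987RG1, (0.4) p.253] -/
theorem small_comp_map_iff (hembj : ∀ y : Site Q (j + 1), φ j (emb y) = emb (φ (j + 1) y)) (U : GaugeField Q j G) (c : PBond Q (j + 1)) :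
    Small ℰ (U ∘ fun b : PBond Q j => (⟨φ j b.src, b.dir⟩ : PBond Q j)) c ↔ Small ℰ U (⟨φ (j + 1) c.src, c.dir⟩ : PBond Q (j + 1)) := by
  simp only [BlockAveraging.Small, loopHol_comp_map φ hs hu hembj]

include hs hu in
/-- the correction factor of (0.4) is natural. [cite: Balaban1987RG1, (0.4) p.253] -/
theorem corr_comp_map (hembj : ∀ y : Site Q (j + 1), φ j (emb y) = emb (φ (j + 1) y)) (U : GaugeField Q j G) (c : PBond Q (j + 1)) :
    corr ℰ (U ∘ fun b : PBond Q j => (⟨φ j b.src, b.dir⟩ : PBond Q j)) c = corr ℰ U (⟨φ (j + 1) c.src, c.dir⟩ : PBond Q (j + 1)) := by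
  classical
  unfold BlockAveraging.corr
  have hl : loopHol (U ∘ fun b : PBond Q j => (⟨φ j b.src, b.dir⟩ : PBond Q j)) c = loopHol U (⟨φ (j + 1) c.src, c.dir⟩ : PBond Q (j + 1)) :=
    funext fun i => loopHol_comp_map φ hs hu hembj U c i
  simp only [small_comp_map_iff φ hs hu ℰ hembj, hl]

include hs hu in
/-- ★ **BAŁABAN'S (0.4) BLOCK AVERAGE IS NATURAL**: `M(U ∘ φ♭_j) = M(U) ∘ φ♭_{j+1}`, given block-centre compatibility at level `j`. [cite: Balaban1987RG1, (0.4) p.253] -/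
theorem avgFun_comp_map (hembj : ∀ y : Site Q (j + 1), φ j (emb y) = emb (φ (j + 1) y)) (U : GaugeField Q j G) :
    avgFun ℰ (U ∘ fun b : PBond Q j => (⟨φ j b.src, b.dir⟩ : PBond Q j)) = avgFun ℰ U ∘ fun c : PBond Q (j + 1) => (⟨φ (j + 1) c.src, c.dir⟩ : PBond Q (j + 1)) := by
  funext c
  simp only [BlockAveraging.avgFun, Function.comp_apply, corr_comp_map φ hs hu ℰ hembj, axialAvg_comp_map φ hs hembj]

include hs hu in
/-- ★ **THE ITERATED (0.4) AVERAGE IS NATURAL**: `M^{k}(U ∘ φ♭₀) = M^{k}(U) ∘ φ♭_k`, given block-centre compatibility at every level `< k`. [cite: Balaban1987RG1, (0.11) p.253] -/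
theorem iter_blockAvg_comp_map (U : GaugeField Q 0 G) :
    ∀ k : ℕ, (∀ i, i + 1 ≤ k → ∀ y : Site Q (i + 1), φ i (emb y) = emb (φ (i + 1) y)) →
      Averaging.iter (fun i => blockAvg (P := Q) (j := i) ℰ) k (U ∘ fun b : PBond Q 0 => (⟨φ 0 b.src, b.dir⟩ : PBond Q 0)) =
        Averaging.iter (fun i => blockAvg (P := Q) (j := i) ℰ) k U ∘ fun c : PBond Q k => (⟨φ k c.src, c.dir⟩ : PBond Q k)
  | 0, _ => rfl
  | k + 1, hemb => by
    have ih := iter_blockAvg_comp_map U k (fun i hi y => hemb i (by omega) y)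
    show avgFun ℰ (Averaging.iter (fun i => blockAvg (P := Q) (j := i) ℰ) k (U ∘ fun b : PBond Q 0 => (⟨φ 0 b.src, b.dir⟩ : PBond Q 0))) =
      avgFun ℰ (Averaging.iter (fun i => blockAvg (P := Q) (j := i) ℰ) k U) ∘ fun c : PBond Q (k + 1) => (⟨φ (k + 1) c.src, c.dir⟩ : PBond Q (k + 1))
    rw [ih]
    exact avgFun_comp_map φ hs hu ℰ (hemb k le_rfl) _

end Average

end Endo

/-! ## §2 The deck translations of the cover are block-compatible lattice endomorphisms -/

section Deck

variable (P : Params) (jc : ℕ) (c : Fin P.d → ℕ)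

/-- translation commutes with `+e_μ`. [folklore] -/
theorem deck_shift (i : ℕ) (x : Site (cover P jc) i) (μ : Fin P.d) :
    (fun ν => (x.shift μ) ν + ((c ν * P.sitesPerDir i : ℕ) : ZMod ((cover P jc).sitesPerDir i))) =
      Site.shift (P := cover P jc) (fun ν => x ν + ((c ν * P.sitesPerDir i : ℕ) : ZMod ((cover P jc).sitesPerDir i))) μ := by
  funext ν
  simp only [Site.shift, Function.update_apply]
  by_cases h : ν = μ
  · subst h; simp only [if_true]; ring
  · simp only [if_neg h]

/-- translation commutes with `−e_μ`. [folklore] -/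
theorem deck_unshift (i : ℕ) (x : Site (cover P jc) i) (μ : Fin P.d) :
    (fun ν => (x.unshift μ) ν + ((c ν * P.sitesPerDir i : ℕ) : ZMod ((cover P jc).sitesPerDir i))) =
      Site.unshift (P := cover P jc) (fun ν => x ν + ((c ν * P.sitesPerDir i : ℕ) : ZMod ((cover P jc).sitesPerDir i))) μ := by
  funext ν
  simp only [Site.unshift, Function.update_apply]
  by_cases h : ν = μ
  · subst h; simp only [if_true]; ring
  · simp only [if_neg h]

/-- ★ **BLOCK CENTRES COMMUTE WITH THE DECK TRANSLATIONS**: `emb (ỹ + c·N_{i+1}) = emb ỹ + c·N_i` (`N_i = 2L^{m+K−i} = L·N_{i+1}` for `i + 1 ≤ m + K`, all read in the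
cover's `ZMod (N_i·L^{jc})`). [cite: Balaban1987RG1, (0.1) p.252] -/
theorem emb_deck (i : ℕ) (hi : i + 1 ≤ P.m + P.K) (y : Site (cover P jc) (i + 1)) :
    emb (P := cover P jc) (fun ν => y ν + ((c ν * P.sitesPerDir (i + 1) : ℕ) : ZMod ((cover P jc).sitesPerDir (i + 1)))) =
      fun ν => emb (P := cover P jc) y ν + ((c ν * P.sitesPerDir i : ℕ) : ZMod ((cover P jc).sitesPerDir i)) := by
  funext ν
  unfold emb
  have hL : (cover P jc).L = P.L := rfl
  have hNi : (cover P jc).sitesPerDir i = (cover P jc).L * (cover P jc).sitesPerDir (i + 1) :=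
    sitesPerDir_eq_mul_succ (cover P jc) i (by show i + 1 ≤ P.m + jc + P.K; omega)
  have hPi : P.sitesPerDir i = P.L * P.sitesPerDir (i + 1) := sitesPerDir_eq_mul_succ P i hi
  rw [← Nat.cast_add, ZMod.natCast_eq_natCast_iff, hNi, hL, hPi]
  -- `((y + c N') mod (L^{jc}·… )) · L + h ≡ (y·L + h) + c·(L·N')  (mod L·Ñ')`
  have hval : ((y ν + ((c ν * P.sitesPerDir (i + 1) : ℕ) : ZMod ((cover P jc).sitesPerDir (i + 1)))).val) ≡
      (y ν).val + c ν * P.sitesPerDir (i + 1) [MOD (cover P jc).sitesPerDir (i + 1)] := by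
    rw [ZMod.val_add, ZMod.val_natCast]
    exact (Nat.mod_modEq _ _).trans (Nat.ModEq.add_left _ (Nat.mod_modEq _ _))
  have h1 := (Nat.ModEq.mul_right' P.L hval)
  -- multiply the modulus by `L` on both sides: `a ≡ b [MOD N'] ⇒ a·L ≡ b·L [MOD N'·L] = [MOD L·N']`
  have h2 : (y ν + ((c ν * P.sitesPerDir (i + 1) : ℕ) : ZMod ((cover P jc).sitesPerDir (i + 1)))).val * P.L ≡
      ((y ν).val + c ν * P.sitesPerDir (i + 1)) * P.L [MOD P.L * (cover P jc).sitesPerDir (i + 1)] := by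
    rw [mul_comm P.L]; exact h1
  calc (y ν + ((c ν * P.sitesPerDir (i + 1) : ℕ) : ZMod ((cover P jc).sitesPerDir (i + 1)))).val * P.L + (P.L - 1) / 2
      ≡ ((y ν).val + c ν * P.sitesPerDir (i + 1)) * P.L + (P.L - 1) / 2 [MOD P.L * (cover P jc).sitesPerDir (i + 1)] := Nat.ModEq.add_right _ h2
    _ = (y ν).val * P.L + (P.L - 1) / 2 + c ν * (P.L * P.sitesPerDir (i + 1)) := by ring

/-- the deck vectors lie in the kernel of the covering map. [cite: Balaban1987RG1, (0.1) p.251] -/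
theorem proj_deckVec (i : ℕ) :
    proj P jc i (fun ν => ((c ν * P.sitesPerDir i : ℕ) : ZMod ((cover P jc).sitesPerDir i))) = proj P jc i (fun _ => 0) := by
  funext ν
  apply ZMod.val_injective
  rw [val_proj, val_proj, ZMod.val_zero, Nat.zero_mod, ZMod.val_natCast, Nat.mod_mod_of_dvd _ (sitesPerDir_dvd P jc i), Nat.mul_mod_left]

/-- ★ **THE COVERING MAP IS DECK-INVARIANT**: `proj (x̃ + c·N_i) = proj x̃`. [cite: Balaban1987RG1, (0.1) p.251] -/
theorem proj_deck (i : ℕ) (x : Site (cover P jc) i) :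
    proj P jc i (fun ν => x ν + ((c ν * P.sitesPerDir i : ℕ) : ZMod ((cover P jc).sitesPerDir i))) = proj P jc i x :=
  proj_add_ker P jc i x _ (proj_deckVec P jc c i)

/-- translating back by the same vector. [folklore] -/
theorem deck_sub_cancel (i : ℕ) (x : Site (cover P jc) i) :
    (fun ν => (x ν - ((c ν * P.sitesPerDir i : ℕ) : ZMod ((cover P jc).sitesPerDir i))) + ((c ν * P.sitesPerDir i : ℕ) : ZMod ((cover P jc).sitesPerDir i))) = x := by
  funext ν; exact sub_add_cancel _ _

/-- the deck translation of sites is a bijection. [folklore] -/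
theorem deck_bijective (i : ℕ) :
    Function.Bijective fun x : Site (cover P jc) i => (fun ν => x ν + ((c ν * P.sitesPerDir i : ℕ) : ZMod ((cover P jc).sitesPerDir i)) : Site (cover P jc) i) := by
  refine ⟨fun x y h => ?_, fun y => ⟨fun ν => y ν - ((c ν * P.sitesPerDir i : ℕ) : ZMod ((cover P jc).sitesPerDir i)), deck_sub_cancel P jc c i y⟩⟩
  funext ν
  have := congrFun h ν
  exact add_right_cancel this

/-! ## §3 The instances: the (0.4) average, the plaquettes and the action on the cover are deck-covariant -/

section Instances

variable {G : Type*} [GaugeGroup G]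

/-- ★ plaquette holonomies of a deck-translated field. [cite: Balaban1985Averaging, (9) p.19] -/
theorem plaqHol_comp_deck {j : ℕ} (U : GaugeField (cover P jc) j G) (p : Plaq (cover P jc) j) :
    GaugeField.plaqHol (U ∘ fun b : PBond (cover P jc) j =>
        (⟨fun ν => b.src ν + ((c ν * P.sitesPerDir j : ℕ) : ZMod ((cover P jc).sitesPerDir j)), b.dir⟩ : PBond (cover P jc) j)) p =
      GaugeField.plaqHol U ⟨fun ν => p.src ν + ((c ν * P.sitesPerDir j : ℕ) : ZMod ((cover P jc).sitesPerDir j)), p.μ, p.ν, p.hμν⟩ :=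
  plaqHol_comp_map (Q := cover P jc) (fun i x => fun ν => x ν + ((c ν * P.sitesPerDir i : ℕ) : ZMod ((cover P jc).sitesPerDir i)))
    (fun i x μ => (deck_shift P jc c i x μ)) U p

/-- `PlaqSmall` is deck-invariant. [cite: Balaban1987RG1, (0.18) p.255] -/
theorem plaqSmall_comp_deck_iff {j : ℕ} (δ : ℝ) (U : GaugeField (cover P jc) j G) :
    PlaqSmall δ (U ∘ fun b : PBond (cover P jc) j =>
        (⟨fun ν => b.src ν + ((c ν * P.sitesPerDir j : ℕ) : ZMod ((cover P jc).sitesPerDir j)), b.dir⟩ : PBond (cover P jc) j)) ↔ PlaqSmall δ U := by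
  refine ⟨fun h p => ?_, fun h => plaqSmall_comp_map (Q := cover P jc)
    (fun i x => fun ν => x ν + ((c ν * P.sitesPerDir i : ℕ) : ZMod ((cover P jc).sitesPerDir i))) (fun i x μ => deck_shift P jc c i x μ) h⟩
  have := h ⟨fun ν => p.src ν - ((c ν * P.sitesPerDir j : ℕ) : ZMod ((cover P jc).sitesPerDir j)), p.μ, p.ν, p.hμν⟩
  rw [plaqHol_comp_deck] at this
  simpa only [deck_sub_cancel] using this

variable (ℰ : LoopAverage G)

/-- ★★ **THE (0.4) BLOCK AVERAGE ON THE COVER COMMUTES WITH THE DECK TRANSLATIONS** (`j + 1 ≤ m + K`). [cite: Balaban1987RG1, (0.4) p.253] -/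
theorem avgFun_comp_deck {j : ℕ} (hj : j + 1 ≤ P.m + P.K) (U : GaugeField (cover P jc) j G) :
    avgFun ℰ (U ∘ fun b : PBond (cover P jc) j =>
        (⟨fun ν => b.src ν + ((c ν * P.sitesPerDir j : ℕ) : ZMod ((cover P jc).sitesPerDir j)), b.dir⟩ : PBond (cover P jc) j)) =
      avgFun ℰ U ∘ fun b : PBond (cover P jc) (j + 1) =>
        (⟨fun ν => b.src ν + ((c ν * P.sitesPerDir (j + 1) : ℕ) : ZMod ((cover P jc).sitesPerDir (j + 1))), b.dir⟩ : PBond (cover P jc) (j + 1)) :=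
  avgFun_comp_map (Q := cover P jc) (fun i x => fun ν => x ν + ((c ν * P.sitesPerDir i : ℕ) : ZMod ((cover P jc).sitesPerDir i)))
    (fun i x μ => deck_shift P jc c i x μ) (fun i x μ => deck_unshift P jc c i x μ) ℰ (fun y => (emb_deck P jc c j hj y).symm) U

/-- ★★ **THE ITERATED (0.4) AVERAGE ON THE COVER COMMUTES WITH THE DECK TRANSLATIONS** (`k ≤ m + K`). [cite: Balaban1987RG1, (0.11) p.253] -/
theorem iter_blockAvg_comp_deck (U : GaugeField (cover P jc) 0 G) (k : ℕ) (hk : k ≤ P.m + P.K) :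
    Averaging.iter (fun i => blockAvg (P := cover P jc) (j := i) ℰ) k (U ∘ fun b : PBond (cover P jc) 0 =>
        (⟨fun ν => b.src ν + ((c ν * P.sitesPerDir 0 : ℕ) : ZMod ((cover P jc).sitesPerDir 0)), b.dir⟩ : PBond (cover P jc) 0)) =
      Averaging.iter (fun i => blockAvg (P := cover P jc) (j := i) ℰ) k U ∘ fun b : PBond (cover P jc) k =>
        (⟨fun ν => b.src ν + ((c ν * P.sitesPerDir k : ℕ) : ZMod ((cover P jc).sitesPerDir k)), b.dir⟩ : PBond (cover P jc) k) :=
  iter_blockAvg_comp_map (Q := cover P jc) (fun i x => fun ν => x ν + ((c ν * P.sitesPerDir i : ℕ) : ZMod ((cover P jc).sitesPerDir i)))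
    (fun i x μ => deck_shift P jc c i x μ) (fun i x μ => deck_unshift P jc c i x μ) ℰ U k
    (fun i hi y => (emb_deck P jc c i (by omega) y).symm)

/-- ★ **THE WILSON ACTION IS DECK-INVARIANT** (reindex the plaquette sum along the bijective translation). [cite: Balaban1987RG1, (0.2) p.252] -/
theorem wilsonAction_comp_deck {j : ℕ} (w : ℝ) (U : GaugeField (cover P jc) j G) :
    wilsonAction w (U ∘ fun b : PBond (cover P jc) j =>
        (⟨fun ν => b.src ν + ((c ν * P.sitesPerDir j : ℕ) : ZMod ((cover P jc).sitesPerDir j)), b.dir⟩ : PBond (cover P jc) j)) = wilsonAction w U := by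
  unfold wilsonAction
  have hplaq : ∀ p : Plaq (cover P jc) j, GaugeField.plaqHol (U ∘ fun b : PBond (cover P jc) j =>
        (⟨fun ν => b.src ν + ((c ν * P.sitesPerDir j : ℕ) : ZMod ((cover P jc).sitesPerDir j)), b.dir⟩ : PBond (cover P jc) j)) p =
      GaugeField.plaqHol U ⟨fun ν => p.src ν + ((c ν * P.sitesPerDir j : ℕ) : ZMod ((cover P jc).sitesPerDir j)), p.μ, p.ν, p.hμν⟩ :=
    fun p => plaqHol_comp_deck P jc c U p
  simp only [hplaq]
  -- reindex along the plaquette translation (a bijection of a finite type)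
  let τ : Plaq (cover P jc) j → Plaq (cover P jc) j := fun p =>
    ⟨fun ν => p.src ν + ((c ν * P.sitesPerDir j : ℕ) : ZMod ((cover P jc).sitesPerDir j)), p.μ, p.ν, p.hμν⟩
  have hτ : Function.Bijective τ := by
    refine (Finite.injective_iff_bijective).1 fun p q h => ?_
    have hsrc := congrArg Plaq.src h
    have hμ := congrArg Plaq.μ h
    have hν := congrArg Plaq.ν h
    have hs' : p.src = q.src := (deck_bijective P jc c j).1 hsrc
    cases p; cases q
    simp only at hs' hμ hν
    subst hs'; subst hμ; subst hν; rfl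
  exact Fintype.sum_bijective τ hτ _ _ fun p => rfl

omit [GaugeGroup G] in
/-- **A LIFT IS DECK-INVARIANT**: `(U ∘ projBond) ∘ τ♭ = U ∘ projBond`. [cite: Balaban1987RG1, (0.1) p.251] -/
theorem comp_projBond_comp_deck {j : ℕ} (U : GaugeField P j G) :
    (U ∘ projBond P jc j) ∘ (fun b : PBond (cover P jc) j =>
        (⟨fun ν => b.src ν + ((c ν * P.sitesPerDir j : ℕ) : ZMod ((cover P jc).sitesPerDir j)), b.dir⟩ : PBond (cover P jc) j)) = U ∘ projBond P jc j := by
  funext b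
  simp only [Function.comp_apply, projBond, proj_deck]

end Instances

end Deck

end Summit.QuantumFields.YangMills.Theorems.CoverDeckNaturality
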